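import Summits.BirchSwinnertonDyer.Rank1Residual.GaloisImage.KolyvaginSystemOfEulerSystemPropagated
import Summits.BirchSwinnertonDyer.Rank1Residual.GaloisImage.KolyvaginSystemOfEulerSystemBadPlaces
import HarnessLib

/-!
# THEOREM D for `𝓕_can` on the rows WITH ANOMALOUS bad places: a Kolyvagin system in
# `KS(E[p^k·p], 𝓕_can, 𝒫″)` from an Euler system of `T_pE/ℚ`, the bad places discharged by T-DER-BN
# (cell `b2b-bsdres`, team n1011; row T-DER-D4BN, file F2 = the END; seat p15 GEN 9; socket = n1011-p11
# GEN 10's D1/D2/D3b/D5a/D4 BY NAME, the three-way case split at the non-good places is this file's)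

HONEST FRAMING (cell `b2b-bsdres`, run/shared/lean/b2b/bsd-rank1-residual/, verbatim in every
file): the goal of the cell is to DELETE the COMBINATION-SHAPED residual classes of the
Birch–Swinnerton-Dyer formula for ALL analytic-rank `≤ 1` elliptic curves over `ℚ` — "full BSD
formula for every rank `≤ 1` curve in class `C`" assembled STRICTLY from published theorems — so
that the rank-`≤ 1` remainder becomes exactly the CONSTRUCTION-SHAPED classes, which are TYPED
(missing-input `Prop`s), NOT attempted. This is not "finishing BSD". Team n1011 (N10/N11; route-1
PORT, (P-DER) clause C1/C0): research route on the CONSTRUCTION-SHAPED class X4; TOOL theorem;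
nothing booked; no mark / label / count moved. No definition, no named fact, no `sorry`.

## What

n1011-p11's D4 `Derivative.Rat.exists_isKolyvaginSystem_propagatedSelmerStructure` turns an Euler
system `c` of `T_pE` (hypothesis `hc`; the PORT binds Kato's `ZetaBody … |>.1`) into a Kolyvagin system
for Mazur–Rubin's `𝓕_can = propagatedSelmerStructure W p k` on `E[p^k·p]` on the rows where
`E(ℚ_w)[p] = 0` at EVERY bad `w ≠ p` (`hbad`) — 1 602 of the 6 238 N11 rows (n1011-p15 GEN 7 census,
kit j143811). **`exists_isKolyvaginSystem_propagatedSelmerStructure_of_primes''`** is the same END with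
`hbad` REPLACED by

* `hcomp : π_{k+1} = e ∘ red` (GZ-4's pin of the coefficient quotient `(T′, red, e)` to the canonical
  projection `T_pE → E[p^{k+1}]`; holds for the PORT's `torsionRepPadicInt` reading), and
* `hP'' :` every Kolyvagin prime `q ∈ 𝒫` satisfies **`p ∤ orderOf (w : ZMod q)` for every ANOMALOUS bad
  place `w ≠ p`** (one with a non-zero `p`-torsion point over `ℚ_w`) — the prime set `𝒫″` of ROUTE-1
  §43.5 (a)/§45.4 (positive Chebotarev density; census: witnesses below `10⁶` for 100 % / 97.6 % /
  70.3 % of the N11 rows at `k+1 = 1 / 2 / 3`),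

so that the remaining 4 636 rows (those WITH an anomalous bad place) are served. Proof = D5a's
assembly (D1 `CyclotomicLevel.Rat.exists_sigma_mem_inertia_adicCompletionPrime`; `h0` from `Irr(E[p])`
by `geomTorsion_eq_zero_of_fixed_level`; D2 `exists_derivativeFamily`; D3b
`isKolyvaginSystem_derivativeFamily_of_transverse_eq`) with D3b's displayed local clause `hSloc`
discharged by a three-way split at a place `w ∉ d` that is not (good ∧ `≠ p`): `w ∣ p` → `htop`;
bad `w` with `E(ℚ_w)[p] = 0` → D4's `propagatedSelmerStructure_inr_eq_top_of_torsion_eq_zero` (F10);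
ANOMALOUS bad `w` → F1 `Rat.localization_mem_propagatedSelmerStructure_of_res_eq_deriv_of_forall_not_dvd_orderOf`
(T-DER-BN ∘ GZ-4) on the `T′`-valued class `Φ₀⁻¹(κ_d)` (GZ-1 `exists_addEquiv_oneCocycleClass`, pulled
back by C5b-β′ `CoeffTransport.resSubgroup_symm_eq_noncommProd_deriv`, exactly as D3b does for the
transverse clause), `hP''` supplying `p ∤ ord(w mod q)` for every `q ∈ d`.

HONEST LIMITS: no Euler system asserted; the place `p` stays the displayed `htop` (`t = 0` rows:
F11/F12; additive `t > 0`: p11's D5b); no certificate that a given prime lies in `𝒫″` (records);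
values C2/C3 not here; closes nothing by itself.

References: B. Mazur, K. Rubin, Mem. AMS 799 (2004), Def. 3.2.1, Thm. 3.2.4, App. A; K. Rubin,
*Euler Systems* (2000) Thm. 4.5.1; K. Rubin, PCMI 18 (2011) §3.1; J. Milne, *ADT*, I Thm. 2.8.
-/

noncomputable section

open CategoryTheory Function Finset Polynomial Field IsDedekindDomain
open scoped NumberField Classical
open Literature.NumberTheory.GaloisRepresentations Literature.NumberTheory.EllipticCurves
open Literature.NumberTheory.GaloisRepresentations.DiscreteGaloisModule
open Literature.NumberTheory.GaloisCohomology
open Summit.BirchSwinnertonDyer.Rank1Residual.GaloisImage.CoeffTransport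
open Summit.BirchSwinnertonDyer.Rank1Residual.GaloisImage.CyclotomicLevel
open Rat.HeightOneSpectrum

universe u

namespace Summit.BirchSwinnertonDyer.Rank1Residual.GaloisImage.Derivative.Rat

variable (W : WeierstrassCurve ℚ) [W.IsElliptic] [W.IsGloballyMinimal] (p : ℕ) [Fact p.Prime]
variable [Module.Free ℤ_[p] (W.tateModule p)] [Module.Finite ℤ_[p] (W.tateModule p)]
  [ContinuousSMul ℤ_[p] (W.tateModule p)]

/-- Local notation: `T∞ = T_p E` as a continuous `G_ℚ`-representation. -/
local notation3 "T∞" => WeierstrassCurve.tateGaloisRep W p (W.continuous_galoisRepTate_holds p)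

/-- Local notation: `𝐫⟦f, T′, U⟧ = f_* : H¹(U, T_pE) → H¹(U, T′)`. -/
local notation3 (prettyPrint := false) "𝐫⟦" f ", " Tg ", " U "⟧" =>
  ContinuousCohomology.map (ContinuousMonoidHom.id _)
    (X := subgroupRep (ContinuousRep.toTopRep T∞) U)
    (Y := subgroupRep (ContinuousRep.toTopRep Tg) U)
    ((TopRep.resFunctor (Subgroup.subtype U)).map f) 1

variable (S : Set (HeightOneSpectrum (𝓞 ℚ)))

/-- Local notation: `𝓛` = the cyclotomic Euler-system levels `ℚ(μ_{p^{n+1}}, μ_r)`, `r ∩ S = ∅`. -/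
local notation3 "𝓛" => cyclotomicLevelsRat p S

/-- Local notation: `𝐃⟦A, X, U, τ⟧ ℓ = ∑_{j < ℓ−1} j·(τ_ℓ)_*^j`, Kolyvagin's derivative operator of
the place `ℓ` on `H¹(U, X)` (`A`-linear) for the generator `τ_ℓ`. -/
local notation3 (prettyPrint := false) "𝐃⟦" A ", " X ", " U ", " τ "⟧" =>
  fun ℓ : HeightOneSpectrum (𝓞 ℚ) =>
  ∑ j ∈ Finset.range (((primesEquiv ℓ : Nat.Primes) : ℕ) - 1),
    (j : Module.End A (continuousCohomology 1 (subgroupRep X U))) *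
      (conjMap X U ((τ : HeightOneSpectrum (𝓞 ℚ) → absoluteGaloisGroup ℚ) ℓ) 1).hom.toLinearMap ^ j

/-- **THEOREM D for `𝓕_can = propagatedSelmerStructure W p k` on a `𝒫″`-datum** (rows WITH anomalous
bad places allowed): every binder of n1011-p11's D4
`exists_isKolyvaginSystem_propagatedSelmerStructure` with `hbad` replaced by `hcomp` (`π_{k+1} = e ∘ red`)
and `hP''` (`p ∤ ord(w mod q)` for every `q ∈ 𝒫` and every bad `w ≠ p` carrying a non-zero
`p`-torsion point over `ℚ_w`); `htop` at `p` unchanged. Conclusion identical to D4's: generators `σ`,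
transports `Φ_r`, ONE family `κ` with `D.IsKolyvaginSystem (propagatedSelmerStructure W p k) κ` and the
derivative characterisation at every level.
[cite: MazurRubin2004, Def. 3.2.1, Thm. 3.2.4 and App. A] [cite: Rubin2000, Thm. 4.5.1]
[cite: Rubin2011, §3.1 (p. 29)] -/
theorem exists_isKolyvaginSystem_propagatedSelmerStructure_of_primes'' (hp2 : p ≠ 2)
    {c : ∀ (i : ℕ) (r : (𝓛).Ideals), H1 T∞ ((𝓛).level i r.1)}
    (hc : IsEulerSystem 𝓛 T∞ p c)
    {M' : Type} [AddCommGroup M'] [Module ℤ_[p] M'] [TopologicalSpace M'] [DiscreteTopology M']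
    [IsTopologicalAddGroup M'] [ContinuousSMul ℤ_[p] M'] {T' : GaloisRep ℚ ℤ_[p] M'}
    (red : T∞.toTopRep ⟶ T'.toTopRep) (hred : Function.Surjective red.hom)
    {k : ℕ} (hM : ∀ m : M', ((p : ℤ_[p]) ^ (k + 1)) • m = 0)
    (e : M' →+ WeierstrassCurve.geomTorsion W ((p : ℤ) ^ k * (p : ℤ))) (hec : Continuous e)
    (he : ∀ (g : absoluteGaloisGroup ℚ) (x : M'),
      e (T'.toTopRep.ρ g x) = (W.torsionGaloisModule ((p : ℤ) ^ k * (p : ℤ))).toTopRep.ρ g (e x))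
    (einv : WeierstrassCurve.geomTorsion W ((p : ℤ) ^ k * (p : ℤ)) →+ M') (hic : Continuous einv)
    (h₁ : ∀ x, einv (e x) = x) (h₂ : ∀ y, e (einv y) = y)
    (hcomp : ∀ a : W.tateModule p, tateToTorsion W p k a = e (red.hom a))
    (hirr : W.HasIrreducibleModPGaloisRep p)
    (D : KolyvaginDatum (W.torsionGaloisModule ((p : ℤ) ^ k * (p : ℤ))))
    (hT : D.transverse = cyclotomicTransverse (W.torsionGaloisModule ((p : ℤ) ^ k * (p : ℤ))))
    {η : (ℓ : HeightOneSpectrum (𝓞 ℚ)) → (ZMod (Ideal.absNorm ℓ.asIdeal))ˣ}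
    (hD : D.HasCanonicalComparison (p ^ (k + 1)) η)
    (hPr : D.primes ⊆ (𝓛).primes)
    (hKol : ∀ ℓ ∈ D.primes, Kato.IsKolyvaginPrime W p (k + 1) ((primesEquiv ℓ : Nat.Primes) : ℕ))
    (hP'' : ∀ q ∈ D.primes, ∀ w : HeightOneSpectrum (𝓞 ℚ), ¬ W.HasGoodReductionAt w →
      ((primesEquiv w : Nat.Primes) : ℕ) ≠ p →
      (∃ P : (W.baseChange (w.adicCompletion ℚ)).toAffine.Point, p • P = 0 ∧ P ≠ 0) →
        ¬ p ∣ orderOf ((((primesEquiv w : Nat.Primes) : ℕ) : ZMod ((primesEquiv q : Nat.Primes) : ℕ))))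
    (htop : ∀ w : HeightOneSpectrum (𝓞 ℚ), ((primesEquiv w : Nat.Primes) : ℕ) = p →
      propagatedSelmerStructure W p k (Sum.inr w) = ⊤) :
    ∃ (σ : HeightOneSpectrum (𝓞 ℚ) → absoluteGaloisGroup ℚ)
      (Φ : ∀ r : Finset (HeightOneSpectrum (𝓞 ℚ)),
        continuousCohomology 1 (subgroupRep T'.toTopRep ((𝓛).level ⊥ r)) →+
          continuousCohomology 1 (subgroupRep
            (W.torsionGaloisModule ((p : ℤ) ^ k * (p : ℤ))).toTopRep ((𝓛).level ⊥ r)))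
      (comm : ∀ r : Finset (HeightOneSpectrum (𝓞 ℚ)),
        ((r : Finset _) : Set (HeightOneSpectrum (𝓞 ℚ))).Pairwise fun a b =>
          Commute (𝐃⟦ℤ, (W.torsionGaloisModule ((p : ℤ) ^ k * (p : ℤ))).toTopRep, ((𝓛).level ⊥ r), σ⟧ a)
            (𝐃⟦ℤ, (W.torsionGaloisModule ((p : ℤ) ^ k * (p : ℤ))).toTopRep, ((𝓛).level ⊥ r), σ⟧ b))
      (κ : Finset (HeightOneSpectrum (𝓞 ℚ)) →
        galoisCohomology (W.torsionGaloisModule ((p : ℤ) ^ k * (p : ℤ))) 1),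
      (∀ ℓ, σ ℓ ∈ (adicCompletionPrime ℚ ℓ).inertia (absoluteGaloisGroup ℚ)) ∧
      (∀ ℓ, modNCyclotomicCharacter ℚ (Ideal.absNorm ℓ.asIdeal) (σ ℓ) = η ℓ) ∧
      (∀ r, ∀ (φ : contOneCocycles (subgroupRep T'.toTopRep ((𝓛).level ⊥ r)))
        (ψ : contOneCocycles (subgroupRep
          (W.torsionGaloisModule ((p : ℤ) ^ k * (p : ℤ))).toTopRep ((𝓛).level ⊥ r))),
        (∀ g, ψ.1 g = e (φ.1 g)) → Φ r (oneCocycleClass _ φ) = oneCocycleClass _ ψ) ∧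
      D.IsKolyvaginSystem (propagatedSelmerStructure W p k) κ ∧
      (∀ r : Finset (HeightOneSpectrum (𝓞 ℚ)), ¬ (↑r : Set _) ⊆ D.primes → κ r = 0) ∧
      ∀ (r : Finset (HeightOneSpectrum (𝓞 ℚ))) (hr : (↑r : Set _) ⊆ D.primes),
        resSubgroup (W.torsionGaloisModule ((p : ℤ) ^ k * (p : ℤ))).toTopRep ((𝓛).level ⊥ r) 1 (κ r) =
          (r.noncommProd 𝐃⟦ℤ, (W.torsionGaloisModule ((p : ℤ) ^ k * (p : ℤ))).toTopRep,
              ((𝓛).level ⊥ r), σ⟧ (comm r))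
            (Φ r (𝐫⟦red, T', ((𝓛).level ⊥ r)⟧
              (c ⊥ ⟨r, fun _ hq => hPr (hr (Finset.mem_coe.2 hq))⟩))) := by
  have hm : (p : ℤ) ^ k * (p : ℤ) = ((p ^ (k + 1) : ℕ) : ℤ) := by push_cast; ring
  -- the generators (D1)
  obtain ⟨σ, hσI, hσχ, -, hσ⟩ := CyclotomicLevel.Rat.exists_sigma_mem_inertia_adicCompletionPrime p S η
    D.primes (fun ℓ hℓ => hD.zpowers_eq_top hℓ)
  -- `h0` at every level from `Irr(E[p])`
  have h0 : ∀ r : Finset (HeightOneSpectrum (𝓞 ℚ)), (↑r : Set _) ⊆ D.primes →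
      ∀ P : WeierstrassCurve.geomTorsion W ((p : ℤ) ^ k * (p : ℤ)),
        (∀ u : (𝓛).level ⊥ r, (u : absoluteGaloisGroup ℚ) • P = P) → P = 0 :=
    fun r _ P hP => geomTorsion_eq_zero_of_fixed_level W p S hp2 hirr hm ⊥ r P hP
  -- the family (D2)
  obtain ⟨Φ, comm, hΦ, κ, hκ0, hκ⟩ := exists_derivativeFamily W p S hc red (Nat.succ_pos k) hM e hec
    he einv hic h₁ h₂ D.primes hPr hKol σ hσ h0
  -- the global transport (GZ-1), for the pull-back of the classes to `T′`
  obtain ⟨Φ₀, hΦ₀⟩ := exists_addEquiv_oneCocycleClass T'.toTopRep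
    (W.torsionGaloisModule ((p : ℤ) ^ k * (p : ℤ))).toTopRep e hec he einv hic h₁ h₂
  refine ⟨σ, Φ, comm, κ, hσI, hσχ, hΦ, ?_, hκ0, fun r hr => (hκ r hr).1⟩
  -- THEOREM D-core with the transverse clause discharged (D3b); the non-good places by the split
  refine isKolyvaginSystem_derivativeFamily_of_transverse_eq W p S hp2 hc red hred (Nat.succ_pos k) hM
    hm e hec he einv hic h₁ h₂ D hT hD hPr hKol σ (fun ℓ _ => hσI ℓ) (fun ℓ _ => hσχ ℓ) hσ h0 Φ hΦ comm
    κ hκ0 (fun r hr => (hκ r hr).1) (propagatedSelmerStructure W p k)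
    (fun w hw hne => (propagatedSelmerStructure_inr_eq_unramifiedSubgroup W p k
      (WeierstrassCurve.natCast_not_mem_asIdeal_of_primesEquiv_ne Fact.out hne) hw).ge)
    fun d hd w hwd hw => ?_
  by_cases hwp : ((primesEquiv w : Nat.Primes) : ℕ) = p
  · -- the place `p`: the displayed certificate
    rw [htop w hwp]
    exact AddSubgroup.mem_top _
  have hbad : ¬ W.HasGoodReductionAt w := fun hgood => hw ⟨hgood, hwp⟩
  by_cases htors : ∀ P : (W.baseChange (w.adicCompletion ℚ)).toAffine.Point, p • P = 0 → P = 0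
  · -- a bad place with `E(ℚ_w)[p] = 0`: the condition is vacuous (F10)
    rw [propagatedSelmerStructure_inr_eq_top_of_torsion_eq_zero W p k
      (WeierstrassCurve.natCast_not_mem_asIdeal_of_primesEquiv_ne Fact.out hwp) htors]
    exact AddSubgroup.mem_top _
  · -- an ANOMALOUS bad place: T-DER-BN ∘ GZ-4 on the pulled-back class, under `𝒫″`
    have hanom : ∃ P : (W.baseChange (w.adicCompletion ℚ)).toAffine.Point, p • P = 0 ∧ P ≠ 0 := by
      by_contra hcon
      exact htors fun P hP => by
        by_contra hP0
        exact hcon ⟨P, hP, hP0⟩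
    have hordq : ∀ q ∈ d, ¬ p ∣ orderOf ((((primesEquiv w : Nat.Primes) : ℕ) :
        ZMod ((primesEquiv q : Nat.Primes) : ℕ))) :=
      fun q hq => hP'' q (hd (Finset.mem_coe.2 hq)) w hbad hwp hanom
    have hwd' : ∀ q ∈ d, q ≠ w := fun q hq hqw => hwd (hqw ▸ hq)
    -- the pulled-back class and its derivative characterisation (C5b-β′, as in D3b)
    have hκX := resSubgroup_symm_eq_noncommProd_deriv T'.toTopRep
      (W.torsionGaloisModule ((p : ℤ) ^ k * (p : ℤ))).toTopRep e hec he einv h₁ h₂ ((𝓛).level ⊥ d)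
      Φ₀ hΦ₀ (Φ d) (hΦ d) σ _ d
      (pairwise_commute_deriv (L := 𝓛) (T' := T') ⊥ d σ
        (fun ℓ => ((primesEquiv ℓ : Nat.Primes) : ℕ) - 1)) (comm d) _ (κ d) ((hκ d hd).1)
    rw [← Φ₀.apply_symm_apply (κ d)]
    exact Rat.localization_mem_propagatedSelmerStructure_of_res_eq_deriv_of_forall_not_dvd_orderOf W p k
      red e hec (fun g x => he g x) hcomp Φ₀.toAddMonoidHom (fun φ ψ h => hΦ₀ φ ψ h)
      ⟨d, fun _ hq => hPr (hd (Finset.mem_coe.2 hq))⟩ σ _ _ (Φ₀.symm (κ d)) hκX w hwd' hordq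

end Summit.BirchSwinnertonDyer.Rank1Residual.GaloisImage.Derivative.Rat

end
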